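/-
Copyright (c) 2026 the pub-hodgecm-mathlib formalisation cell (harness21).  Prover seat hodgecm-mathlib-A-p19 (g27), 2026-09-02.  Road «S3-tree»∕«S3-ram» (LEAD F0P3a-plan (g12)
T11-41∕T11-52; owner p06 (g15)), row (e2) «P-2-ram»∕«R2²-ram», organ «THE LAW IN EIGEN-DATA» — the right side of ★ p847397 `RationalGoodVectorRamifiedPlace` (and of ★ p847219
`RationalGoodVectorRamifiedBaseLaw`) rewritten in the (D1) eigen-data tokens `(u, t, D, d₀, det J)` of the CM torus and pulled back to the base local field.
-/
import Mathlib.LinearAlgebra.Matrix.GeneralLinearGroup.Defs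
import Mathlib.Data.Matrix.Basic
import Mathlib.LinearAlgebra.Matrix.Determinant.Basic
import Mathlib.RingTheory.Polynomial.Basic
import Mathlib.Tactic.LinearCombination
import Mathlib.Tactic.FieldSimp
import Mathlib.Tactic.Ring
import HarnessLib

/-!
# The law in eigen-data: `−(θσθ)·x₁₂²` is a rational norm, and `d₀·det J·x₀₁x₀₂ = ι₁(d₀·det J·(u² − tu + D)∕((1+u)²(1+t+D)))` (Rogawski 1990 §4.9; Jacobowitz 1962 §7)

Topic `NumberTheory/Automorphic`; namespace `Literature.NumberTheory.Automorphic.SymmetricEigenframe`.  THEOREMS ONLY (no definition, no instance, no notation, no named fact, no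
`sorry`); kernel lane `--supports stmt-HodgeConjecture-24833`.  Cell `pub/hodgecm-mathlib` (D-0151), crux H413; road «S3-tree», seeding wave «S3-ram», row «R2²-ram»; organ **«THE LAW IN
EIGEN-DATA»** (this seat), FIELD-GENERIC: two fields `j : E →+* K` (`ι₁ : L_w → M_W`), ring endomorphisms `σ` (`σ_K`) and `ι` (`ι′`) of `K`, `σE` (`σ_w`) of `E` with `σ ∘ j = j ∘ σE` and
`Fix ι = j(E)`; the symmetric eigenframe nodes `γ = (γ₀, γ₁, γ₂)` with `σγᵢ = γᵢ⁻¹`, `ιγ₁ = γ₂`, `ιγ₂ = γ₁`, `ιθ = −θ`, and the Cayley quotients `x_ij := (γᵢ − γⱼ)∕((1+γᵢ)(1+γⱼ))`.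
The right side of ★ `exists_selfDual_cyclic_iff_rational_norm_type{A,B}_of_ramified` ∕ ★ `exists_norm_symmCriterion_iff_exists_rational_norm` is
`∃ a, ιa = a ∧ a·σa·(−(θ·σθ)·d 0·det J_K·(x₀₁x₀₂)·x₁₂²) = 1`.

* §1 **`cayleyQuotient_map_eq_neg`** (`σ x_ij = −x_ij` from `σγ = γ⁻¹`), **`neg_mul_map_mul_cayleyQuotient_sq_eq_norm`**: `−(θ·σθ)·x₁₂² = (θ·x₁₂)·σ(θ·x₁₂)` — in BOTH torus types the
  factor `−(θσθ)·x₁₂²` is the `σ`-norm of the `ι`-FIXED element `θ·x₁₂` (no sign, no `ε`-class), **`exists_rational_norm_mul_iff_of_frame`**: the right side is equivalent to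
  `∃ a, ιa = a ∧ a·σa·(d 0·det J_K·x₀₁x₀₂) = 1`.
* §2 **`cayleyQuotient_zero_one_mul_zero_two_eq`**: `x₀₁·x₀₂ = (γ₀² − (γ₁+γ₂)γ₀ + γ₁γ₂)∕((1+γ₀)²(1 + (γ₁+γ₂) + γ₁γ₂))`; with the (D1) eigen-tokens `γ₀ = ju`, `γ₁ + γ₂ = jt`,
  `γ₁γ₂ = jD`, `d 0 = j d₀`, `J_K = J.map j`: **`gramValue_mul_det_mul_cayleyQuotient_eq_map`**: `d 0·det J_K·x₀₁x₀₂ = j(d₀·det J·(u² − tu + D)∕((1+u)²(1+t+D)))`.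
* §3 **`exists_rational_norm_mul_map_iff`** (pull-back along `j`: `(∃ a, ιa = a ∧ a·σa·jX = 1) ↔ ∃ z, z·σE z·X = 1`) and the assembled head
  **`exists_rational_norm_law_iff_of_eigenData`**: the law's right side `↔ ∃ z : E, z·σE z·(d₀·det J·(u² − tu + D)∕((1+u)²(1+t+D))) = 1` — «GOOD ⟺ `d₀·det J·χ_λ(u)∕((1+u)²χ_λ(−1))`
  is a norm from `L_w`» (CERT 5cd795ce `κ_good = χ(det J)·μ_w((u−λ)(u−ι′λ))·…`, 841 + 5312 exact cases).  HONEST LABEL: HC_CM is proved only modulo the 2 remaining named inputs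
  (hLiu418 24832, h413 24833) until rung 0 closes; field algebra, count-neutral.

## References
* [Rogawski1990] J. D. Rogawski, *Automorphic Representations of Unitary Groups in Three Variables* (1990): §4.9 Lemma 4.9.3 p. 56, Prop. 4.9.1 (b) p. 55.
* [Jacobowitz1962] R. Jacobowitz, *Hermitian forms over local fields*, Amer. J. Math. 84 (1962): §7.
-/

set_option autoImplicit false

noncomputable section

open Finset Matrix

namespace Literature.NumberTheory.Automorphic.SymmetricEigenframe

/-! ## §1 `−(θσθ)·x₁₂²` is the norm of the rational element `θ·x₁₂` -/

section Frame

variable {K : Type*} [Field K] (σ ι : K →+* K)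

/-- **`σ` NEGATES A CAYLEY QUOTIENT**: `σγᵢ = γᵢ⁻¹` (`γᵢ ≠ 0`, `1 + γᵢ ≠ 0`) gives `σ((γᵢ − γⱼ)∕((1+γᵢ)(1+γⱼ))) = −(γᵢ − γⱼ)∕((1+γᵢ)(1+γⱼ))`.
[cite: Rogawski1990, §4.9 Lemma 4.9.3 p. 56] -/
theorem cayleyQuotient_map_eq_neg {a b : K} (ha : a ≠ 0) (hb : b ≠ 0) (ha1 : 1 + a ≠ 0) (hb1 : 1 + b ≠ 0) (hσa : σ a = a⁻¹) (hσb : σ b = b⁻¹) :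
    σ ((a - b) / ((1 + a) * (1 + b))) = -((a - b) / ((1 + a) * (1 + b))) := by
  have ha1' : 1 + a⁻¹ ≠ 0 := fun h => ha1 (by
    have : a * (1 + a⁻¹) = 0 := by rw [h, mul_zero]
    rw [mul_add, mul_one, mul_inv_cancel₀ ha] at this
    rwa [add_comm] at this)
  have hb1' : 1 + b⁻¹ ≠ 0 := fun h => hb1 (by
    have : b * (1 + b⁻¹) = 0 := by rw [h, mul_zero]
    rw [mul_add, mul_one, mul_inv_cancel₀ hb] at this
    rwa [add_comm] at this)
  have e1 : (1 + a⁻¹) * (1 + b⁻¹) = (1 + a) * (1 + b) * (a * b)⁻¹ := by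
    have h1 : (1 + a) * a⁻¹ = 1 + a⁻¹ := by rw [add_mul, one_mul, mul_inv_cancel₀ ha, add_comm]
    have h2 : (1 + b) * b⁻¹ = 1 + b⁻¹ := by rw [add_mul, one_mul, mul_inv_cancel₀ hb, add_comm]
    rw [← h1, ← h2, mul_inv]; ring
  rw [map_div₀, map_sub, map_mul, map_add, map_add, map_one, hσa, hσb, div_eq_iff (mul_ne_zero ha1' hb1'), e1, inv_sub_inv ha hb,
    div_eq_iff (mul_ne_zero ha hb)]
  have hD : (1 + a) * (1 + b) ≠ 0 := mul_ne_zero ha1 hb1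
  calc b - a = -(a - b) := by ring
    _ = -((a - b) / ((1 + a) * (1 + b)) * ((1 + a) * (1 + b))) := by rw [div_mul_cancel₀ _ hD]
    _ = -((a - b) / ((1 + a) * (1 + b))) * ((1 + a) * (1 + b) * (a * b)⁻¹) * (a * b) := by
        rw [mul_assoc, mul_assoc, inv_mul_cancel₀ (mul_ne_zero ha hb), mul_one, neg_mul]

/-- **`−(θ·σθ)·x₁₂² = (θ·x₁₂)·σ(θ·x₁₂)`** — the factor `−(θσθ)·x₁₂²` of the law is the `σ`-NORM of `θ·x₁₂`, whatever `σθ` is (both torus types), since `σx₁₂ = −x₁₂`.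
[cite: Rogawski1990, §4.9 Lemma 4.9.3 p. 56] [cite: Jacobowitz1962, §7] -/
theorem neg_mul_map_mul_cayleyQuotient_sq_eq_norm (θ : K) {a b : K} (ha : a ≠ 0) (hb : b ≠ 0) (ha1 : 1 + a ≠ 0) (hb1 : 1 + b ≠ 0)
    (hσa : σ a = a⁻¹) (hσb : σ b = b⁻¹) :
    -(θ * σ θ) * ((a - b) / ((1 + a) * (1 + b))) ^ 2 = (θ * ((a - b) / ((1 + a) * (1 + b)))) * σ (θ * ((a - b) / ((1 + a) * (1 + b)))) := by
  rw [map_mul, cayleyQuotient_map_eq_neg σ ha hb ha1 hb1 hσa hσb]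
  ring

/-- **NORM ABSORPTION**: for an `ι`-fixed `m ≠ 0`, `(∃ a, ιa = a ∧ a·σa·(X·(m·σm)) = 1) ↔ ∃ a, ιa = a ∧ a·σa·X = 1` (`a ↦ a·m`), when `σ` commutes with `ι`. [cite: Jacobowitz1962, §7] -/
theorem exists_rational_norm_mul_norm_iff (hσι : ∀ z, σ (ι z) = ι (σ z)) {m : K} (hιm : ι m = m) (hm : m ≠ 0) (X : K) :
    (∃ a : K, ι a = a ∧ a * σ a * (X * (m * σ m)) = 1) ↔ ∃ a : K, ι a = a ∧ a * σ a * X = 1 := by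
  have hσm : σ m ≠ 0 := fun h => by
    have h' : ι (σ m) = 0 := by rw [h, map_zero]
    rw [← hσι, hιm] at h'
    exact hm ((map_eq_zero σ).1 h')
  constructor
  · rintro ⟨a, hιa, ha⟩
    refine ⟨a * m, by rw [map_mul, hιa, hιm], ?_⟩
    rw [map_mul]; linear_combination ha
  · rintro ⟨a, hιa, ha⟩
    refine ⟨a * m⁻¹, by rw [map_mul, map_inv₀, hιa, hιm], ?_⟩
    rw [map_mul, map_inv₀]
    field_simp
    linear_combination ha

/-- **THE LAW'S RIGHT SIDE WITHOUT `θ` AND `x₁₂`**: with `ιθ = −θ`, `θ ≠ 0`, nodes `γ` with `σγᵢ = γᵢ⁻¹`, `γᵢ ≠ 0`, `1 + γᵢ ≠ 0`, `γ₁ ≠ γ₂`, `ιγ₁ = γ₂`, `ιγ₂ = γ₁`, and `σι = ισ`: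
`(∃ a, ιa = a ∧ a·σa·(−(θσθ)·d₀·δ·(x₀₁x₀₂)·x₁₂²) = 1) ↔ ∃ a, ιa = a ∧ a·σa·(d₀·δ·(x₀₁x₀₂)) = 1`. [cite: Rogawski1990, §4.9 Lemma 4.9.3 p. 56] [cite: Jacobowitz1962, §7] -/
theorem exists_rational_norm_mul_iff_of_frame (hσι : ∀ z, σ (ι z) = ι (σ z)) {θ : K} (hιθ : ι θ = -θ) (hθ : θ ≠ 0)
    {γ : Fin 3 → K} (hσγ : ∀ i, σ (γ i) = (γ i)⁻¹) (hγne : ∀ i, γ i ≠ 0) (hγ1 : ∀ i, 1 + γ i ≠ 0) (h12 : γ 1 ≠ γ 2)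
    (hιγ1 : ι (γ 1) = γ 2) (hιγ2 : ι (γ 2) = γ 1) (d₀ δ A : K) :
    (∃ a : K, ι a = a ∧ a * σ a * (-(θ * σ θ) * d₀ * δ * A * ((γ 1 - γ 2) / ((1 + γ 1) * (1 + γ 2))) ^ 2) = 1) ↔
      ∃ a : K, ι a = a ∧ a * σ a * (d₀ * δ * A) = 1 := by
  have hx : -(θ * σ θ) * d₀ * δ * A * ((γ 1 - γ 2) / ((1 + γ 1) * (1 + γ 2))) ^ 2
      = d₀ * δ * A * ((θ * ((γ 1 - γ 2) / ((1 + γ 1) * (1 + γ 2)))) * σ (θ * ((γ 1 - γ 2) / ((1 + γ 1) * (1 + γ 2))))) := by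
    rw [← neg_mul_map_mul_cayleyQuotient_sq_eq_norm σ θ (hγne 1) (hγne 2) (hγ1 1) (hγ1 2) (hσγ 1) (hσγ 2)]; ring
  rw [hx]
  refine exists_rational_norm_mul_norm_iff σ ι hσι ?_ ?_ _
  · rw [map_mul, hιθ, map_div₀, map_sub, map_mul, map_add, map_add, map_one, hιγ1, hιγ2]; ring
  · refine mul_ne_zero hθ (div_ne_zero (sub_ne_zero.2 h12) (mul_ne_zero (hγ1 1) (hγ1 2)))

/-! ## §2 `x₀₁·x₀₂` in the symmetric functions of `γ₁, γ₂` -/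

/-- **`x₀₁·x₀₂ = (γ₀² − (γ₁+γ₂)γ₀ + γ₁γ₂)∕((1+γ₀)²·(1 + (γ₁+γ₂) + γ₁γ₂))`** (an identity of rational functions; junk-valued when `1 + γᵢ = 0`). [cite: Rogawski1990, §4.9 Lemma 4.9.3 p. 56] -/
theorem cayleyQuotient_zero_one_mul_zero_two_eq (γ : Fin 3 → K) :
    (γ 0 - γ 1) / ((1 + γ 0) * (1 + γ 1)) * ((γ 0 - γ 2) / ((1 + γ 0) * (1 + γ 2)))
      = (γ 0 ^ 2 - (γ 1 + γ 2) * γ 0 + γ 1 * γ 2) / ((1 + γ 0) ^ 2 * (1 + (γ 1 + γ 2) + γ 1 * γ 2)) := by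
  have h12 : 1 + (γ 1 + γ 2) + γ 1 * γ 2 = (1 + γ 1) * (1 + γ 2) := by ring
  rw [h12, div_mul_div_comm]
  congr 1 <;> ring

end Frame

section EigenData

variable {E K : Type*} [Field E] [Field K] (j : E →+* K) (σE : E →+* E) (σ ι : K →+* K)

/-- **THE RATIONAL FACTOR IN EIGEN-DATA**: with `γ₀ = ju`, `γ₁ + γ₂ = jt`, `γ₁γ₂ = jD`, `d 0 = j d₀`, `J_K = J.map j`:
`d 0·det J_K·(x₀₁x₀₂) = j(d₀·det J·((u² − tu + D)∕((1+u)²(1+t+D))))`. [cite: Rogawski1990, §4.9 Lemma 4.9.3 p. 56] -/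
theorem gramValue_mul_det_mul_cayleyQuotient_eq_map {γ : Fin 3 → K} {u t D d₀ : E} {d0 : K}
    (hγ0 : γ 0 = j u) (hsum : γ 1 + γ 2 = j t) (hprod : γ 1 * γ 2 = j D) (hd0 : d0 = j d₀) (J : Matrix (Fin 3) (Fin 3) E) :
    d0 * (J.map j).det * ((γ 0 - γ 1) / ((1 + γ 0) * (1 + γ 1)) * ((γ 0 - γ 2) / ((1 + γ 0) * (1 + γ 2))))
      = j (d₀ * J.det * ((u ^ 2 - t * u + D) / ((1 + u) ^ 2 * (1 + t + D)))) := by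
  rw [cayleyQuotient_zero_one_mul_zero_two_eq γ, hsum, hprod, hγ0, hd0, map_mul, map_mul, map_div₀, ← RingHom.mapMatrix_apply, ← RingHom.map_det]
  congr 2
  · simp only [map_add, map_sub, map_mul, map_pow]
  · simp only [map_add, map_mul, map_pow, map_one]

/-! ## §3 Pull-back along `j` and the assembled head -/

/-- **PULL-BACK ALONG `j`**: if `Fix ι = j(E)` and `σ ∘ j = j ∘ σE`, then for `X ∈ E`: `(∃ a, ιa = a ∧ a·σa·jX = 1) ↔ ∃ z : E, z·σE z·X = 1`. [cite: Jacobowitz1962, §7] -/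
theorem exists_rational_norm_mul_map_iff (hσj : ∀ x, σ (j x) = j (σE x)) (hfix : ∀ a : K, ι a = a ↔ ∃ x, j x = a) (X : E) :
    (∃ a : K, ι a = a ∧ a * σ a * j X = 1) ↔ ∃ z : E, z * σE z * X = 1 := by
  constructor
  · rintro ⟨a, hιa, ha⟩
    obtain ⟨z, rfl⟩ := (hfix a).1 hιa
    refine ⟨z, j.injective ?_⟩
    rw [map_mul, map_mul, ← hσj, map_one]; exact ha
  · rintro ⟨z, hz⟩
    refine ⟨j z, (hfix _).2 ⟨z, rfl⟩, ?_⟩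
    rw [hσj, ← map_mul, ← map_mul, hz, map_one]

/-- **THE LAW IN EIGEN-DATA (assembled).**  In the symmetric eigenframe (`σ ∘ ι = ι ∘ σ`, `ιθ = −θ`, `θ ≠ 0`; nodes `γ` with `σγᵢ = γᵢ⁻¹`, `γᵢ ≠ 0`, `1 + γᵢ ≠ 0`, `γ₁ ≠ γ₂`,
`ιγ₁ = γ₂`, `ιγ₂ = γ₁`), with the (D1) eigen-tokens `γ₀ = ju`, `γ₁ + γ₂ = jt`, `γ₁γ₂ = jD`, `d 0 = j d₀`, and `Fix ι = j(E)`, `σ ∘ j = j ∘ σE`: the right side of ★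
`exists_selfDual_cyclic_iff_rational_norm_type{A,B}_of_ramified` is equivalent to **`∃ z : E, z·σE z·(d₀·det J·((u² − tu + D)∕((1+u)²(1+t+D)))) = 1`** — «GOOD iff
`d₀·det J·χ_λ(u)∕((1+u)²·χ_λ(−1))` is a `σ_w`-norm», the same text for both torus types. [cite: Rogawski1990, §4.9 Lemma 4.9.3 p. 56, Prop. 4.9.1 (b) p. 55] [cite: Jacobowitz1962, §7] -/
theorem exists_rational_norm_law_iff_of_eigenData (hσj : ∀ x, σ (j x) = j (σE x)) (hfix : ∀ a : K, ι a = a ↔ ∃ x, j x = a)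
    (hσι : ∀ z, σ (ι z) = ι (σ z)) {θ : K} (hιθ : ι θ = -θ) (hθ : θ ≠ 0)
    {γ : Fin 3 → K} (hσγ : ∀ i, σ (γ i) = (γ i)⁻¹) (hγne : ∀ i, γ i ≠ 0) (hγ1 : ∀ i, 1 + γ i ≠ 0) (h12 : γ 1 ≠ γ 2)
    (hιγ1 : ι (γ 1) = γ 2) (hιγ2 : ι (γ 2) = γ 1)
    {u t D d₀ : E} {d0 : K} (hγ0 : γ 0 = j u) (hsum : γ 1 + γ 2 = j t) (hprod : γ 1 * γ 2 = j D) (hd0 : d0 = j d₀) (J : Matrix (Fin 3) (Fin 3) E) :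
    (∃ a : K, ι a = a ∧ a * σ a * (-(θ * σ θ) * d0 * (J.map j).det *
        ((γ 0 - γ 1) / ((1 + γ 0) * (1 + γ 1)) * ((γ 0 - γ 2) / ((1 + γ 0) * (1 + γ 2)))) * ((γ 1 - γ 2) / ((1 + γ 1) * (1 + γ 2))) ^ 2) = 1) ↔
      ∃ z : E, z * σE z * (d₀ * J.det * ((u ^ 2 - t * u + D) / ((1 + u) ^ 2 * (1 + t + D)))) = 1 := by
  rw [exists_rational_norm_mul_iff_of_frame σ ι hσι hιθ hθ hσγ hγne hγ1 h12 hιγ1 hιγ2,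
    gramValue_mul_det_mul_cayleyQuotient_eq_map j hγ0 hsum hprod hd0 J]
  exact exists_rational_norm_mul_map_iff j σE σ ι hσj hfix _

end EigenData

end Literature.NumberTheory.Automorphic.SymmetricEigenframe

end
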